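import Summits.HubbardSuperconductivity.HubbardSuperconductivity.Theorems.AnisotropyChordTowerLadder
import Summits.HubbardSuperconductivity.HubbardSuperconductivity.Theorems.AnisotropyChordTransferSectors

/-!
# Route `AnisotropyChord` / H0 rotor rung: the two SUPPORT HYPOTHESES of the TOWER LADDER theorem hold

`condensateOnWindow_of_towerFidelity` (THEOREM TOWER LADDER, `…AnisotropyChordTowerLadder`, theory seat cycle 11) carries
two typed support statements as hypotheses, both marked «provable; port»:

* `PerronSectorSupport Δ` — a Perron amplitude of the sector `Sᶻ_tot = M` is supported on the configurations with `|V|/2 + M`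
  particles: this is the tree's `perron_support` (`…AnisotropyChordTowerBridge`);
* `PerronSectorDownward Δ` — if the sector `M + 1` (`M ≥ 0`) carries a Perron amplitude then so does the sector `M`: the
  sector `M + 1` is non-empty (support of the given amplitude), hence `|V|/2 + M` is a natural number `≤ |V|`, and the tree's
  `exists_perron_of_weight` (`…AnisotropyChordTransferSectors`, Perron–Frobenius on a non-trivial sector) provides the
  amplitude.

Hence `perronSectorSupport_holds`, `perronSectorDownward_holds`, and the TOWER LADDER theorem with the two hypotheses
discharged, `condensateOnWindow_of_towerFidelity'`.  Prover seat `hubbard-h0-rotor-p1` g20; helper for the S-bridge dossier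
of stmt-HubbardSuperconductivity-19089.  No definition is introduced; nothing here is a statement about the Hubbard model.
-/

set_option linter.dupNamespace false
set_option autoImplicit false

noncomputable section

open Finset
open Literature.MathematicalPhysics.QuantumLattice Literature.Probability.LatticeModels
open Summit.HubbardSuperconductivity.HubbardSuperconductivity.Theorems.AnisotropyChord.InsertionEntropy
open Summit.HubbardSuperconductivity.HubbardSuperconductivity.Theorems.AnisotropyChord.Transfer

namespace Summit.HubbardSuperconductivity.HubbardSuperconductivity.Theorems.AnisotropyChord.Tower

/-- **`PerronSectorSupport` holds** (it is `perron_support`). [folklore] -/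
theorem perronSectorSupport_holds (Δ : ℝ) : PerronSectorSupport Δ := by
  intro L _ M a ha σ hσ
  have h := perron_support ha σ hσ
  unfold zerosCard at h
  exact h

/-- **`PerronSectorDownward` holds**: a Perron amplitude in the sector `M + 1 ≥ 1` forces `|V|/2 + M ∈ ℕ`, `≤ |V|`, and the
sector `M` carries a Perron amplitude by Perron–Frobenius (`exists_perron_of_weight`). [folklore] -/
theorem perronSectorDownward_holds (Δ : ℝ) : PerronSectorDownward Δ := by
  intro L _ M hM hex
  obtain ⟨a, ha⟩ := hex
  -- a support point of `a`
  obtain ⟨σ₀, hσ₀⟩ : ∃ σ, a σ ≠ 0 := by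
    by_contra h
    push Not at h
    have hu := ha.unit
    simp [h] at hu
  have hK := perron_support ha σ₀ hσ₀
  -- `K = |V|/2 + M + 1` particles, a natural number between `1` and `|V|`
  set K : ℕ := (univ.filter fun x => σ₀ x = 0).card with hKdef
  have hKreal : (K : ℝ) = (Fintype.card (TorusSite 2 L) : ℝ) / 2 + (M + 1) := by
    rw [← hK]
    rfl
  have hKle : K ≤ Fintype.card (TorusSite 2 L) := by
    rw [hKdef]
    exact (Finset.card_filter_le _ _).trans (Finset.card_univ.le)
  have hcard : Fintype.card (TorusSite 2 L) = L ^ 2 := by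
    rw [Fintype.card_fun, ZMod.card, Fintype.card_fin]
  have hK1 : 1 ≤ K := by
    have h0 : (0 : ℝ) ≤ (Fintype.card (TorusSite 2 L) : ℝ) := Nat.cast_nonneg _
    have h1 : (1 : ℝ) ≤ K := by rw [hKreal]; linarith
    exact_mod_cast h1
  -- the weight (number of holes) of the sector `M`
  obtain ⟨b, hb⟩ := exists_perron_of_weight (L := L) Δ (Fintype.card (TorusSite 2 L) - (K - 1))
    (by rw [hcard]; omega)
  have e : (((Fintype.card (TorusSite 2 L) * 1 : ℕ) : ℝ) / 2
      - ((Fintype.card (TorusSite 2 L) - (K - 1) : ℕ) : ℝ)) = M := by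
    rw [Nat.cast_sub (by omega), Nat.cast_sub hK1, mul_one, Nat.cast_one, hKreal]
    ring
  rw [e] at hb
  exact ⟨b, hb⟩

/-- **THEOREM TOWER LADDER with its two support hypotheses discharged:** half-filling anchor `c₀` ∧ tower fidelity
`≥ 1 − C/|V|` on the window `δ` ⇒ condensation with floor `c₀/4` on a window `δ' > 0`. [folklore] -/
theorem condensateOnWindow_of_towerFidelity' (Δ δ c₀ : ℝ) (hδ : 0 < δ) (hc₀ : 0 < c₀)
    (hA : HalfFillingAnchor Δ c₀) (hT : TowerFidelityWindow Δ δ) :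
    ∃ δ' > 0, CondensateOnWindow Δ δ' (c₀ / 4) :=
  condensateOnWindow_of_towerFidelity Δ δ c₀ hδ hc₀ (perronSectorSupport_holds Δ) (perronSectorDownward_holds Δ) hA hT

end Summit.HubbardSuperconductivity.HubbardSuperconductivity.Theorems.AnisotropyChord.Tower

end
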